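import Summits.CriticalPhenomena.Ising3DConformalLimit.Theses.ReflectionTwin
import Summits.CriticalPhenomena.Ising3DConformalLimit.Theses.LogPolarProxy
import Summits.CriticalPhenomena.Ising3DConformalLimit.Theses.MirrorHoelderCompactness
import Summits.CriticalPhenomena.Ising3DConformalLimit.Theses.ClusterRigidity
import Summits.CriticalPhenomena.Ising3DConformalLimit.Theorems.EnergyNotSigmaSquaredMoebiusLimitExistsDefs
import HarnessLib

/-!
# Sketch — crux idea `inversion-before-existence` for crux `ExistsContinuousLimit`
(stmt-CriticalPhenomena-4582; ideator k=1, round 1, 2026-08-17)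

First-lemma typings only (nothing is proposed from this file).  The objects:

* `IsWeightedInversionCovariant S` — covariance of a correlation family under the unit inversion
  `x ↦ x/‖x‖²` with SOME continuous positive weight `w` (the weight a subsequential proxy transfer
  delivers before `Δ` is known);
* `InversionBegetsDilation` (K2, provable now) — translations + a weighted unit inversion generate the
  dilations: a normalised, continuous, translation-invariant, non-degenerate family that is weighted-inversion
  covariant is scale covariant AND inversion covariant with ONE exponent `Δ` (the weight is forced to be
  `‖x‖^{2Δ}`);
* `SubsequentialInversionTransfer` (K3, provable now) — the cluster-point analogue of LogPolarProxy's
  `ProxyInversionTransfer`: if lattice families `P N` that are EXACTLY symmetric under the unit inversion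
  converge, after position-dependent renormalisation by the pinned `ρ` of `ℤ³`, to a cluster point `S` along a
  subsequence on which the weight ratios converge, then `S` is weighted-inversion covariant;
* `ClusterProxyUniversality` (K1, the open core, abstract form) — every cluster point of the pinned `ℤ³` zoom is
  such a subsequential limit of exactly inversion-symmetric lattice families;
* `ClusterPointsMoebius_of` — the composition K1 → K2 → K3 → (4584) ⟹ item 4657 `ClusterPointsMoebius`, typed
  as an implication `Prop`; and `crux_of` — 6150 ∧ 4659 ⟹ the crux (landed split, by name).
-/

noncomputable section

namespace Summit.CriticalPhenomena.Ising3DConformalLimit.Cruxes.ExistsContinuousLimit.InversionBeforeExistence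

open Literature.Probability.LatticeModels
open Summit.CriticalPhenomena.Ising3DConformalLimit.MoebiusLimitExistsOnlyInteraction
open Summit.CriticalPhenomena.Ising3DConformalLimit.Theses
open Filter Topology

/-- Configuration space shorthand. -/
abbrev E3 : Type := EuclideanSpace ℝ (Fin 3)

/-- Weighted inversion covariance: covariance under the unit inversion with SOME continuous positive weight
`w : ℝ³ ∖ {0} → (0,∞)` (not yet a power of the norm). -/
def IsWeightedInversionCovariant (S : CorrFamily 3) : Prop :=
  ∃ w : E3 → ℝ, (∀ v : E3, v ≠ 0 → 0 < w v) ∧ ContinuousOn w {0}ᶜ ∧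
    ∀ (n : ℕ) (x : Fin n → E3), (∀ i, x i ≠ 0) →
      S n (fun i => EuclideanGeometry.inversion (0 : E3) 1 (x i)) = (∏ i, w (x i)) * S n x

/-- **K2 — FIRST LEMMA (group/cocycle rigidity, provable now).** Translations and one weighted unit inversion
generate the dilations: unit-sphere inversions at two centres at distance `> 2` compose to a hyperbolic Möbius
map conjugate (inside the generated group) to a pure dilation, every ratio `μ > 0` so arises, translation
invariance forces the dilation cocycle to be constant in the position (three-point argument on
`J(x+b)J(y+b) = J(x)J(y)`), continuity makes it `μ^{-Δ}`, and `I₀ ∘ D_μ = D_{1/μ} ∘ I₀` plus `I₀² = id` force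
the inversion weight to be exactly `‖x‖^{2Δ}`. -/
def InversionBegetsDilation : Prop :=
  ∀ S : CorrFamily 3, IsNormalised S → (∀ n, ContinuousOn (S n) (NonCoincident 3 n)) →
    IsTranslationInvariant S → IsNondegenerateTwoPoint S → IsWeightedInversionCovariant S →
    ∃ Δ : ℝ, IsScaleCovariant Δ S ∧ IsInversionCovariant Δ S

/-- The pinned weight ratio at mesh `δ` and point `p ≠ 0`: `ρ_pin(δ‖p‖) / ρ_pin(δ/‖p‖)`
(local renormalisation at `p` over local renormalisation at its inverse point). -/
def pinnedWeightRatio (δ : ℝ) (p : E3) : ℝ :=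
  rhoPin (δ * ‖p‖) / rhoPin (δ / ‖p‖)

/-- **K3 — subsequential inversion transfer (provable now; cluster-point form of LogPolarProxy's
`ProxyInversionTransfer`).** Data: lattice correlation families `P k` (the proxy at resolution `N_k`, amplitudes
included) that are EXACTLY invariant under the unit inversion on configurations off the origin; a mesh sequence
`u k → 0⁺`; a cluster point `S`. Hypotheses: the locally renormalised `P k` converge to `S` locally uniformly on
non-coincident configurations off the origin, and the pinned weight ratios converge locally uniformly off the
origin to a continuous positive `w`. Conclusion: `S` is weighted-inversion covariant (with weight `w²`-type
product read off the ratios). -/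
def SubsequentialInversionTransfer : Prop :=
  ∀ (P : ℕ → CorrFamily 3) (u : ℕ → ℝ) (S : CorrFamily 3) (w : E3 → ℝ),
    (∀ k n (p : Fin n → E3), (∀ i, p i ≠ 0) →
        P k n (fun i => EuclideanGeometry.inversion (0 : E3) 1 (p i)) = P k n p) →
    Tendsto u atTop (𝓝[>] (0 : ℝ)) →
    IsNormalised S → (∀ n, ContinuousOn (S n) (NonCoincident 3 n)) →
    (∀ n, TendstoLocallyUniformlyOn
        (fun k (p : Fin n → E3) => (∏ i, rhoPin (u k * ‖p i‖)) * P k n p) (S n) atTop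
        (NonCoincident 3 n ∩ {p | ∀ i, p i ≠ 0})) →
    (∀ v : E3, v ≠ 0 → 0 < w v) → ContinuousOn w {0}ᶜ →
    TendstoLocallyUniformlyOn (fun k (p : E3) => pinnedWeightRatio (u k) p) w atTop {0}ᶜ →
    IsWeightedInversionCovariant S

/-- **K1 — CLUSTER PROXY UNIVERSALITY (the open core; abstract form).** Every cluster point of the pinned `ℤ³`
zoom is the locally-renormalised limit, along its own mesh sequence, of a sequence of EXACTLY unit-inversion-
symmetric lattice correlation families (intended: the finite log-polar proxy of route LogPolarProxy at matched
resolutions `N_k`, row-dependent n.n. couplings and polar amplitudes absorbed into `P k`), with convergent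
pinned weight ratios. This is `LogPolarProxy.ProxyUniversality` with "(ρ, S) a full-filter limit" replaced by
"S a cluster point along u", i.e. it does NOT presuppose existence. -/
def ClusterProxyUniversality : Prop :=
  ∀ S : CorrFamily 3, IsNormalised S → IsClusterPoint S →
    ∃ (P : ℕ → CorrFamily 3) (u : ℕ → ℝ) (w : E3 → ℝ),
      (∀ k n (p : Fin n → E3), (∀ i, p i ≠ 0) →
          P k n (fun i => EuclideanGeometry.inversion (0 : E3) 1 (p i)) = P k n p) ∧
      Tendsto u atTop (𝓝[>] (0 : ℝ)) ∧
      (∀ n, TendstoLocallyUniformlyOn (fun k => rescaledCorrelator (criticalCorr 3) rhoPin n (u k))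
          (S n) atTop (NonCoincident 3 n)) ∧
      (∀ n, TendstoLocallyUniformlyOn
          (fun k (p : Fin n → E3) => (∏ i, rhoPin (u k * ‖p i‖)) * P k n p) (S n) atTop
          (NonCoincident 3 n ∩ {p | ∀ i, p i ≠ 0})) ∧
      (∀ v : E3, v ≠ 0 → 0 < w v) ∧ ContinuousOn w {0}ᶜ ∧
      TendstoLocallyUniformlyOn (fun k (p : E3) => pinnedWeightRatio (u k) p) w atTop {0}ᶜ

/-- Every (normalised, continuous) cluster point is Möbius covariant with some `Δ > 0` — the content of item
stmt-CriticalPhenomena-4657 `ClusterRigidity.ClusterPointsMoebius`, in the `IsClusterPoint` dress. -/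
def ClusterPointsMoebius' : Prop :=
  ∀ S : CorrFamily 3, IsNormalised S → (∀ n, ContinuousOn (S n) (NonCoincident 3 n)) → IsClusterPoint S →
    ∃ Δ : ℝ, 0 < Δ ∧ IsMoebiusCovariant Δ S

/-- The composition the card claims (typed as a `Prop`; the proof is bookkeeping once K1–K3 and the group lemma
`LogPolarProxy.MoebiusFromTranslationsAndInversion` (item 4584) are in hand, plus three in-tree facts about
cluster points: translation invariance (`MoebiusLimitExists/Negative/FreeTranslations`-type), positivity of the
two-point function and `Δ ∈ [1/2, 1]` from the envelopes). -/
def ClusterPointsMoebius_of : Prop :=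
  ClusterProxyUniversality → SubsequentialInversionTransfer → InversionBegetsDilation →
    LogPolarProxy.MoebiusFromTranslationsAndInversion → ClusterPointsMoebius'

/-- The crux by name from the two children (LANDED split p149785 / p139907, restated here to fix the target). -/
def crux_of : Prop :=
  MirrorHoelderCompactness.TwoPointDoubling → ClusterRigidity.ClusterSetTotallyDisconnected →
    ReflectionTwin.ExistsContinuousLimit

/-- Sanity: the two route copies of the crux agree. -/
example : ReflectionTwin.ExistsContinuousLimit ↔ LogPolarProxy.ExistsContinuousLimit := Iff.rfl

end Summit.CriticalPhenomena.Ising3DConformalLimit.Cruxes.ExistsContinuousLimit.InversionBeforeExistence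

end
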